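import Literature.NumberTheory.EllipticCurves.Rank1Residual.Typed.Basic
import Literature.NumberTheory.EllipticCurves.Rank1Residual.Typed.X10
import Literature.NumberTheory.EllipticCurves.Rank1Residual.X9SmallImage
import Literature.NumberTheory.EllipticCurves.BurungaleCastellaSkinner2025.PPartBSD
import HarnessLib

/-!
# Class X9 (irreducible but NOT surjective image at a good ordinary `p ≥ 5`) and its `p = 3`
# shadow X10b — TYPED missing input (cell `b2b-bsdres`)

HONEST FRAMING (run/shared/lean/b2b/bsd-rank1-residual/): the cell deletes the COMBINATION-SHAPED
residual classes of the BSD formula in analytic rank `≤ 1` from PUBLISHED theorems only and TYPES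
the construction-shaped ones (missing input named; required output at `(E,p)` stated), NOT
attempted; this is not "finishing BSD".

**Class X9** (RESIDUAL-CASES §a.2 v3; `Rank1Residual.ClassX9 W p :=
¬cm ∧ GoodOrd W p ∧ 5 ≤ p ∧ Irr W p ∧ ¬Surj W p ∧ (r = 1 → ¬Semistable W)`): the mod-`p` image
is one of Serre's exceptional proper irreducible subgroups (normaliser of a split / non-split
Cartan subgroup, projective image `𝔖₄`; `𝔄₄`, `𝔄₅` do not occur over `ℚ`). Census v3: ONE pair
with `N < 10⁴`, `2268b1 @ 5` (`r = 0`, `#Ш_an = 1`, image `5S4`), whose BSD at `5` is in print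
per curve (Creutz–Miller 2012, `N < 5000`). Label at input: COMBINATION-SHAPED (low). **X10b**
(referee R6.1/R7.1) = `ClassX10 W 3 ∧ ¬Surj W 3` (`1210k1, 7442c1, 1690i1, 6050x1 @ 3`) is the
same obstruction at `p = 3` and carries X9's label.

**Verdict of the cell (X9 prover gens 1–2; referee R6.8, C7): NOT deletable from print — every
published class-level `p`-part input at an irreducible prime has an UNSATISFIABLE hypothesis on
X9, each now a kernel theorem:**
* (im)/(Im) — "`∃ σ ∈ G_{ℚ(μ_{p^∞})}` with `T/(σ-1)T ≃ ℤ_p`" — of Burungale–Castella–Skinner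
  IMRN 2025 Thm. 1.1.2(b)/Cor. 1.3.1 (= Kato 2004 Thm. 13.4(3) ⊂ (12.5.2) of Thm. 17.4(3);
  Skinner 2016 §2.5 (b); Yan–Zhu 2026 Thm. 4.15 (Im)) and (sur) of Howard 2004 Thm. B (BCS
  Thm. 4.2.1, rank 1): FALSE on X9 for every prime (`ClassX9.not_bigIm`, `X9SmallImage.lean`
  p177578 ← `TateModuleTransvectionCriterionProofs` p177495: such a `σ` is a transvection of
  order `p` on `E[p]`, but `p ∤ #ρ̄(Γ_ℚ)` by Serre's Prop. 15);
* (ram) of Skinner–Urban 2014 Thm. 2 / Skinner 2016 Thm. C (ii) / bsd.S30: FALSE on X9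
  (`ClassX9.not_ram`, `X9NoEntry.lean`: a ramified multiplicative prime gives a transvection);
* (sst) of Jetchev–Skinner–Wan 2017 Thm. 1.2.1: FALSE on X9 in either rank
  (`ClassX9.not_semistable`, Serre 1972 Prop. 21 i) — PROVED in the tree);
* Castella's erratum Thm. A′ / Skinner–Zhang 2014 Thm. 1.2 (PRE anyway) imply (ram);
* Wuthrich 2014 Prop. 21 (the rank-0 upper bound used for X1, X2, X7, X8, X11) EXCLUDES X9
  verbatim: its constant `C` is divisible by "primes for which the Galois representation on
  `E[p]` is neither surjective nor contained in a Borel subgroup" (Doc. Math. 19, p. 400);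
  Stein–Wuthrich 2013's algorithm likewise requires image `= GL₂(𝔽_p)` or Borel (Miller 2011 §5).

**Where (im) is used** (located in the primary texts, X9-ANALYSIS.md §1): BCS arXiv:2405.00270v2
p. 10, proof of Thm. 1.1.2 — "(5.4) `(L_p(g/ℚ)) ⊂ ch_Λ(X_ord(g/ℚ_∞))` in `Λ` if hypothesis (im)
holds, and in `Λ ⊗ ℚ_p` otherwise" via [Kat04, Thm. 17.4], for `g` and its twists `g_K, g_F,
g_{FK}`; the other divisibility (5.3) IS integral (Wan 2015 + Hsieh/Burungale `μ(L^BDP) = 0`,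
p. 5) but only for the PRODUCT of the four twists, and (Heeg) for the auxiliary `K` forces
`r_an(E) + r_an(E^K)` odd, so it cannot be specialised at `T = 0` by Greenberg's control theorem
in analytic rank `0` for all four factors at once (X9-ROUTES-G2.md §2).

**What kind of object is missing** (both halves of the output, both ranks): for `r = 0`, the
INTEGRAL cyclotomic IMC `ch_Λ X_ord(E/ℚ_∞) = (L_p(E))` in `Λ` at a prime with
`p ∤ #ρ̄_{E,p}(Γ_ℚ)` — given BCS Thm. 1.1.2(a) (equality in `Λ ⊗ ℚ_p`, PUBLISHED, tree fact
`burungale_castella_skinner_charIdeal_eq_padicLFunction`) this is exactly the `μ`-invariant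
identity `μ(X_ord) = μ(L_p)`; typed Summits-side as
`Summit.BirchSwinnertonDyer.BirchSwinnertonDyer.Rank1Residual.IntegralMainConjectureOnClassX9`
(`Theorems/Rank1ResidualX9Defs.lean` p177559/p177661, with the typed target `BSDpOnClassX9` and
the bridge `bsdp_of_bsdpOnClassX9` to the shape below). For `r = 1`, additionally the integral
BDP anticyclotomic IMC without (sur) (BCS Thm. 1.2.4(b)'s conclusion; Howard Thm. B / BCK21
Thm. 5.2 printed under full image) and the `r = 0` statement for the twist `E^K`. Announced for
residually DIHEDRAL `p` (Cartan normalisers) in Burungale–Skinner [BS24], NOT OUT (FRESHNESS.md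
§0, 2026-08-18); nothing announced for the `𝔖₄` type (`2268b1 @ 5`).

**Per curve (not class)**: the Heegner-index bounds survive small image — Cha, J. Number Theory
111 (2005) (Miller 2011 Thm. 5.2: `r_an ≤ 1`, `p ∤ 2Δ(K)`, `p² ∤ N`, `ρ̄_{E,p}` irreducible ⟹
`ord_p #Ш(E/ℚ) ≤ 2·ord_p I_K`), GJPST 2009 Thm. 3.7 (= Miller Thm. 5.3), Jetchev 2008 (Miller
Thm. 5.4: `≤ 2(ord_p I_K − max_q ord_p c_q)`) — an UPPER bound by the Heegner index `I_K`, which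
by Gross–Zagier carries `#Ш_an(E^K)·∏ c_q`, so it closes a pair only when a suitable `K` has
`p ∤ I_K` (census rows C11 / T-CHA); Creutz–Miller 2012 (`N < 5000`, tree fact
`bsdp_of_irreducible_of_conductor_lt`) covers `2268b1 @ 5`.

This file (Literature side, the lit seat's `Typed/` vocabulary; referee C8 noted it missing,
`X9SmallImage.lean` refers to it): `X9.MissingInputAt W p := MissingPPartAt W p` and
`X10b.MissingInputAt W := MissingPPartAt W 3`, the conditional class theorems, the exactness of
the type (`X9.missingInputAt_of_bsdp`), and the statement that the type is inhabited by BCS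
Cor. 1.3.1 wherever (im) holds (`X9.missingInputAt_of_cor131`) while (im) fails on X9
(`X9.not_bigIm`) — i.e. the typed residue is precisely the (im)-failure. The universally
quantified statement over the class is not a Literature statement (nothing in print proves it);
it lives Summits-side as `@[conjecture] BSDpOnClassX9` and in CLASSES.md.
-/

noncomputable section

open scoped Classical

open WeierstrassCurve Literature.NumberTheory.EllipticCurves
  Literature.NumberTheory.EllipticCurves.Rank1Residual
  Literature.NumberTheory.EllipticCurves.BurungaleCastellaSkinner2025

namespace Literature.NumberTheory.EllipticCurves.Rank1Residual.Typed

/-! ### X9 -/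

/-- **X9 — the missing input at `(E, p)`, typed**: at a good ordinary `p ≥ 5` with `E[p]`
irreducible but `ρ̄_{E,p}` NOT surjective, NOTHING of the `p`-part is in print at the class level
— the Kato-side integrality (BCS 2025 Thm. 1.1.2(b), Kato 13.4(3), Yan–Zhu 4.15) needs (im),
false on X9 (`ClassX9.not_bigIm`); Skinner 2016 Thm. C needs (ram), false on X9
(`ClassX9.not_ram`); JSW 2017 needs semistability, false on X9 (`ClassX9.not_semistable`);
Wuthrich 2014 Prop. 21 excludes these primes verbatim; Heegner-index bounds (Cha 2005, Jetchev
2008) are per curve — so the missing input is the whole output `MissingPPartAt W p`, to be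
supplied (for `r = 0`) by an INTEGRAL cyclotomic IMC at a prime with `p ∤ #ρ̄(Γ_ℚ)` (the
identity `μ(X_ord) = μ(L_p)` on top of BCS Thm. 1.1.2(a); typed Summits-side in
`Theorems/Rank1ResidualX9Defs.lean`), and (for `r = 1`) an integral BDP anticyclotomic IMC without
(sur); announced for dihedral `p` in [BS24], unrefereed and not public. Nothing asserted. [cite: BurungaleCastellaSkinner2025, Cor. 1.3.1 (p. 4) and (im) (p. 2) (shape only; nothing asserted)] [cite: Miller2011LMS, Def. 1.1 and Thms. 5.2–5.4 (shape only; nothing asserted)] -/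
def X9.MissingInputAt (W : WeierstrassCurve ℚ) (p : ℕ) : Prop := MissingPPartAt W p

/-- **X9 conditional class theorem** (the cell's canonical shape): in analytic rank `≤ 1`, the
typed missing input at an X9 pair yields Miller's `BSD(E,p)` (GZK `hGZK` = bsd.S17 for rank and
finiteness). [cite: Miller2011LMS, §1 and Def. 1.1] -/
theorem X9.bsdp_of_missingInputAt (hGZK : rank_eq_analyticRank_of_analyticRank_le_one)
    (W : WeierstrassCurve ℚ) [W.IsElliptic] [W.IsGloballyMinimal] (p : ℕ) [Fact p.Prime]
    (hr : W.analyticRank ≤ 1) (_hX : ClassX9 W p) (hmiss : X9.MissingInputAt W p) : BSDp W p :=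
  bsdp_of_missingPPartAt W p hGZK hr hmiss

/-- **The type is exact**: conversely `BSD(E,p)` (with `Ш` finite) gives the typed input, so
`X9.MissingInputAt` asks for nothing more than the `p`-part itself. [cite: Miller2011LMS, Def. 1.1] -/
theorem X9.missingInputAt_of_bsdp (W : WeierstrassCurve ℚ) (p : ℕ) [Fact p.Prime]
    [Finite W.sha] (h : BSDp W p) : X9.MissingInputAt W p :=
  missingPPartAt_of_bsdp W p h

/-- **The typed input is exactly the (im)-failure**: on the locus of BCS Cor. 1.3.1 — non-CM,
`p > 3` good ordinary, (irr_ℚ), analytic rank `≤ 1` — the PUBLISHED corollary (tree fact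
`cor131_padicValRat_bsd_rank_le_one`, binder `h`) inhabits `X9.MissingInputAt W p` as soon as
(im) = `BigIm W p` holds; X9 is that locus with (im) replaced by ¬surj(p), where `BigIm` fails
(`X9.not_bigIm`). GZK `hGZK` supplies finiteness. [cite: BurungaleCastellaSkinner2025, Cor. 1.3.1 (p. 4)] -/
theorem X9.missingInputAt_of_cor131 (h : cor131_padicValRat_bsd_rank_le_one)
    (hGZK : rank_eq_analyticRank_of_analyticRank_le_one)
    (W : WeierstrassCurve ℚ) [W.IsElliptic] [W.IsGloballyMinimal] (p : ℕ) [Fact p.Prime]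
    (hcm : ¬ W.HasCM) (hp : 3 < p) (hord : GoodOrd W p) (hirr : Irr W p) (him : BigIm W p)
    (hr : W.analyticRank ≤ 1) : X9.MissingInputAt W p := by
  haveI : Finite W.sha := (hGZK W hr).2
  exact missingPPartAt_of_bsdp W p (bsdp_of_cor131 h hGZK W p hcm hp hord hirr him hr)

/-- **… and (im) is unsatisfiable on X9** (`ClassX9.not_bigIm`, restated next to the type it
obstructs): no instance of `X9.missingInputAt_of_cor131` exists on the class. [cite: BurungaleCastellaSkinner2025, p. 2 hypothesis (im) and Rem. 1.1.3 (iii)] -/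
theorem X9.not_bigIm (W : WeierstrassCurve ℚ) [W.IsElliptic] [W.IsGloballyMinimal] (p : ℕ)
    [Fact p.Prime] (hX : ClassX9 W p) : ¬ BigIm W p :=
  ClassX9.not_bigIm W p hX

/-! ### X10b = `ClassX10 ∧ ¬surj(3)` (referee R6.1 / R7.1: carries X9's label) -/

/-- **X10b — the missing input at `(E, 3)`, typed**: for `ClassX10` (`3` good ordinary, `E[3]`
irreducible, off the printed floor) with `ρ̄_{E,3}` NOT surjective, the hypothesis (Im) of
Yan–Zhu 2026 Thm. 4.15 fails (`ClassX10.not_bigIm_of_not_surj`) exactly as (im) on X9, and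
(ram)/(sst) fail likewise (`X9NoEntry.lean`); the missing input is the whole output at `p = 3`,
`MissingPPartAt W 3` (integral cyclotomic IMC at a prime with `3 ∤ #ρ̄_{E,3}(Γ_ℚ)`; for `r = 1`
also the integral anticyclotomic side). The complementary sub-class X10a′ = `ClassX10 ∧ surj(3)`
is CLOSED in print (`Rank1Residual.bsdp_of_classX10_of_surj`, Yan–Zhu 4.15 + Wuthrich 2014
Lemma 20). Nothing asserted. [cite: YanZhu2024MainConjNonCM, Thm. 4.15 (§4.6), hypothesis (Im) (shape only; nothing asserted)] [cite: Miller2011LMS, Def. 1.1 (shape only; nothing asserted)] -/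
def X10b.MissingInputAt (W : WeierstrassCurve ℚ) : Prop := MissingPPartAt W 3

/-- **X10b conditional class theorem**: in analytic rank `≤ 1`, the typed missing input at an
X10b pair (`ClassX10 W p` — so `p = 3` — with `¬ Surj W 3`) yields `BSD(E,3)`.
[cite: Miller2011LMS, §1 and Def. 1.1] -/
theorem X10b.bsdp_of_missingInputAt (hGZK : rank_eq_analyticRank_of_analyticRank_le_one)
    (W : WeierstrassCurve ℚ) [W.IsElliptic] [W.IsGloballyMinimal] (p : ℕ) [Fact p.Prime]
    (hr : W.analyticRank ≤ 1) (_hX : ClassX10 W p) (_hns : ¬ Surj W 3)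
    (hmiss : X10b.MissingInputAt W) : BSDp W 3 :=
  bsdp_of_missingPPartAt W 3 hGZK hr hmiss

/-- **X10 = X10a′ ⊔ X10b, typed form of the referee's dichotomy R7.1**: at an X10 pair either
`ρ̄_{E,3}` is surjective — then (Im) is available (Wuthrich Lemma 20) and the class is closed in
print by `bsdp_of_classX10_of_surj` — or it is not, and then (Im) FAILS
(`ClassX10.not_bigIm_of_not_surj`) and only the typed input remains. This theorem records the
second branch next to its type. [cite: YanZhu2024MainConjNonCM, Thm. 4.15 (§4.6), hypothesis (Im)] -/
theorem X10b.not_bigIm (W : WeierstrassCurve ℚ) [W.IsElliptic] [W.IsGloballyMinimal] (p : ℕ)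
    [Fact p.Prime] (hX : ClassX10 W p) (hns : ¬ Surj W 3) : ¬ BigIm W 3 :=
  ClassX10.not_bigIm_of_not_surj W p hX hns


/-! ### One vocabulary with `Typed/X10.lean` (referee R6.6/R6.7 dedup) -/

/-- `X10b.MissingInputAt` unfolds to the common currency `MissingPPartAt W 3`. Bookkeeping.
[cite: Miller2011LMS, Def. 1.1] -/
theorem X10b.missingInputAt_iff (W : WeierstrassCurve ℚ) :
    X10b.MissingInputAt W ↔ MissingPPartAt W 3 := Iff.rfl

/-- **Dedup with x10's `Typed/X10.lean` (p178120, landed two minutes after this file)**: on X10b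
(`¬ Surj W 3`) the two typed inputs coincide — `X10.MissingInputAt W := ¬Surj W 3 → MissingPPartAt W 3`
and `X10b.MissingInputAt W := MissingPPartAt W 3` (x10's `X10.missingInputAt_iff_of_not_surj`).
The paper cites ONE: `X10.MissingInputAt` for the class X10 as a whole, `X10b.MissingInputAt` =
`X9.MissingInputAt W 3`-shaped for the merged X9 ∪ X10b row (R7.1). [cite: Miller2011LMS, Def. 1.1] -/
theorem X10b.missingInputAt_iff_x10 (W : WeierstrassCurve ℚ) (hns : ¬ Surj W 3) :
    X10b.MissingInputAt W ↔ X10.MissingInputAt W :=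
  (X10.missingInputAt_iff_of_not_surj W hns).symm

/-- `X9.MissingInputAt W 3 ↔ X10b.MissingInputAt W` — the merged row "X9 with `p ≥ 3`" (R7.1)
has one type. Bookkeeping. [cite: Miller2011LMS, Def. 1.1] -/
theorem X9.missingInputAt_three_iff_x10b (W : WeierstrassCurve ℚ) :
    X9.MissingInputAt W 3 ↔ X10b.MissingInputAt W := Iff.rfl

end Literature.NumberTheory.EllipticCurves.Rank1Residual.Typed
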